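import Summits.CriticalPhenomena.PercolationContinuityZ3.Theorems.PercNearOneGluingNoHeavyLowerTailSahiMixtureLawCells

/-!
# Sahi positivity under mixtures (law level), III: the MIXTURE CONJECTURE IS A THEOREM FOR THREE EVENTS —
# every OR- and AND-mixture of an independent coin into an all-orders-positive triple is Bernstein-positive at every order

Support file of the one-cut programme (crux `NoHeavyLowerTail`, stmt-CriticalPhenomena-4575; cell `prim-masterthm`, seat P3, gen 5;
`run/shared/lean/prim/prim-masterthm/prim-masterthm-p3/HIERARCHY.md` §12).  Vocabulary: `…SahiMixtureLaw` (`coinWeight`, `orCoin`, `andCoin`,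
`BernsteinPos`, `AllOrders`, range lifting `bernsteinPos_sahiE_of_injective`, the typed conjecture `MixtureBernsteinPositivity`),
`…SahiMixtureLawCells` (the square-free cells over pairs and triples).

**`mixture_three`**: for every probability weight `μ` on a finite type, every triple of events `A : Fin 3 → Set α` that is Sahi-nonnegative at
every order (`AllOrders μ A`; what is used: `Cov(A_i,A_j) ≥ 0` and `E_3 ≥ 0` in every slot order), every `F : Fin 3 → Bool` and every multiset of
members `s : Fin m → Fin 3`, BOTH `h ↦ E_m(μ ⊗ coin(h); OR-mixture ∘ s)` and `h ↦ E_m(μ ⊗ coin(h); AND-mixture ∘ s)` are Bernstein-positive of degree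
`m`; **`mixtureBernsteinPositivity_three`**: `MixtureBernsteinPositivity` restricted to `n = 3` holds.  Proof: range lifting reduces to injective `s`
(`m ≤ 3`): `m = 0, 1` trivial, `m = 2, 3` the cells of `…SahiMixtureLawCells` (`bernsteinPos_of_injective_three`).  So for three events the
conjecture needs exactly the square-free rows `Cov ≥ 0`, `E_3 ≥ 0` and cp-mix's certificate.  HONEST FRAMING: `n = 3` only; the conjecture stays
open for `n ≥ 4` (its new cells there are the `m = 4` square-free ones; this seat's kit jobs j096248/j096605: the all-mixed `m = 4` cell is again
`E_4 +` a polynomial with nonnegative coefficients in the cell masses, the `|F| = 2, 3` cells need certificates of degree `≥ 6` or products of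
covariances). [this work]
-/

noncomputable section

open scoped Classical

namespace Summit.CriticalPhenomena.PercolationContinuityZ3.Theorems

open Finset Function
open Literature.Combinatorics.Sahi2008
open Literature.Probability.Percolation.BHK2006 (ind_inter ind_le_one)
open Literature.Probability.Percolation.DecisionTree (ind ind_of_mem ind_of_not_mem ind_nonneg)
open SahiComb

namespace SahiMixture

variable {α : Type*} [Fintype α]

/-! ### The theorem -/

section Main

variable {μ : α → ℝ} (hμ : ∀ a, 0 ≤ μ a) (hμ1 : ∑ a, μ a = 1) (A : Fin 3 → Set α) (hA : AllOrders μ A)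
include hμ hμ1 hA

omit hμ hμ1 in
/-- Covariances of two members, from `AllOrders`. [this work] -/
theorem cov_nonneg_of_allOrders (i j : Fin 3) : ex μ (ind (A i)) * ex μ (ind (A j)) ≤ ex μ (ind (A i) * ind (A j)) := by
  have h := hA 2 ![i, j]
  rw [sahiE_two_apply] at h
  simp only [Matrix.cons_val_zero, Matrix.cons_val_one] at h
  linarith

omit hμ1 hA in
/-- The cells of an injective slot map, for any family of coin-space events whose pair and (ordered) triple cells are Bernstein-positive.
[this work] -/
theorem bernsteinPos_of_injective_three (B : Fin 3 → Set (α × Bool))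
    (h2 : ∀ i j : Fin 3, i ≠ j → BernsteinPos 2 (fun h => sahiE (coinWeight μ h) 2 ![ind (B i), ind (B j)]))
    (h3 : ∀ σ : Equiv.Perm (Fin 3), BernsteinPos 3 (fun h => sahiE (coinWeight μ h) 3 ![ind (B (σ 0)), ind (B (σ 1)), ind (B (σ 2))]))
    (m : ℕ) (s : Fin m → Fin 3) (hs : Injective s) :
    BernsteinPos m (fun h => sahiE (coinWeight μ h) m (fun j => ind (B (s j)))) := by
  have hm : m ≤ 3 := by simpa using Fintype.card_le_of_injective s hs
  interval_cases m
  · exact (bernsteinPos_const 0 le_rfl).congr fun h _ _ => sahiE_zero _ _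
  · refine ((bernsteinPos_ex_coinWeight hμ (g := ind (B (s 0))) fun x => ind_nonneg _ _)).congr fun h _ _ => ?_
    rw [sahiE_one_apply]
  · have h := h2 (s 0) (s 1) (fun e => by have := hs e; exact absurd this (by decide))
    refine h.congr fun h _ _ => ?_
    congr 1; funext j; fin_cases j <;> rfl
  · have hbij : Bijective s := (Fintype.bijective_iff_injective_and_card s).2 ⟨hs, by simp⟩
    have h := h3 (Equiv.ofBijective s hbij)
    refine h.congr fun h _ _ => ?_
    congr 1; funext j; fin_cases j <;> rfl

/-- **THE MIXTURE CONJECTURE HOLDS FOR THREE EVENTS.**  For every probability weight `μ` on a finite type, every triple of events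
`A : Fin 3 → Set α` that is Sahi-nonnegative at every order, every `F : Fin 3 → Bool` and every multiset of members `s : Fin m → Fin 3`:
`h ↦ E_m(μ ⊗ coin(h); (1_{A_{s j} ∪ [F(s j)]·coin})_j)` and `h ↦ E_m(μ ⊗ coin(h); (1_{A_{s j} ∩ ([F(s j)] → coin)})_j)` are Bernstein-positive of
degree `m` — OR-ing or AND-ing an independent event into any sub-collection keeps the triple Sahi-nonnegative at every order, Bernstein-positively
in the mixing weight.  (Square-free cells above + range lifting `bernsteinPos_sahiE_of_injective`; the one genuine certificate is ttrl cp-mix's,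
`…SahiMixtureThreeCell`.) [this work] -/
theorem mixture_three (F : Fin 3 → Bool) (m : ℕ) (s : Fin m → Fin 3) :
    BernsteinPos m (fun h => sahiE (coinWeight μ h) m (fun j => ind (orCoin (A (s j)) (F (s j))))) ∧
    BernsteinPos m (fun h => sahiE (coinWeight μ h) m (fun j => ind (andCoin (A (s j)) (F (s j))))) := by
  have hcov := cov_nonneg_of_allOrders A hA
  have hE3 : ∀ σ : Equiv.Perm (Fin 3), 0 ≤ sahiE μ 3 ![ind (A (σ 0)), ind (A (σ 1)), ind (A (σ 2))] := fun σ => by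
    have h := hA 3 σ
    have e : (fun j => ind (A (σ j))) = ![ind (A (σ 0)), ind (A (σ 1)), ind (A (σ 2))] :=
      funext fun j => by fin_cases j <;> rfl
    rwa [e] at h
  have hne : ∀ (σ : Equiv.Perm (Fin 3)) (i j : Fin 3), i ≠ j → σ i ≠ σ j := fun σ i j hij h => hij (σ.injective h)
  constructor
  · refine bernsteinPos_sahiE_of_injective hμ hμ1 (fun i => orCoin (A i) (F i)) (fun m s hs => ?_) m s
    refine bernsteinPos_of_injective_three hμ (fun i => orCoin (A i) (F i)) (fun i j _ => ?_) (fun σ => ?_) m s hs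
    · exact bernsteinPos_two_orCoin hμ hμ1 (A i) (A j) (hcov i j) (F i) (F j)
    · exact bernsteinPos_three_orCoin hμ hμ1 (A (σ 0)) (A (σ 1)) (A (σ 2)) (hcov _ _) (hcov _ _) (hcov _ _) (hE3 σ)
        (F (σ 0)) (F (σ 1)) (F (σ 2))
  · refine bernsteinPos_sahiE_of_injective hμ hμ1 (fun i => andCoin (A i) (F i)) (fun m s hs => ?_) m s
    refine bernsteinPos_of_injective_three hμ (fun i => andCoin (A i) (F i)) (fun i j _ => ?_) (fun σ => ?_) m s hs
    · exact bernsteinPos_two_andCoin hμ (A i) (A j) (hcov i j) (F i) (F j)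
    · exact bernsteinPos_three_andCoin hμ (A (σ 0)) (A (σ 1)) (A (σ 2)) (hcov _ _) (hcov _ _) (hcov _ _) (hE3 σ)
        (F (σ 0)) (F (σ 1)) (F (σ 2))

omit hA in
/-- Law-level shadow: for every bias `h ∈ [0,1]` the mixed triples are Sahi-nonnegative at every order. [this work] -/
theorem sahiE_mixture_three_nonneg (hA : AllOrders μ A) (F : Fin 3 → Bool) (m : ℕ) (s : Fin m → Fin 3) {h : ℝ} (h0 : 0 ≤ h) (h1 : h ≤ 1) :
    0 ≤ sahiE (coinWeight μ h) m (fun j => ind (orCoin (A (s j)) (F (s j)))) ∧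
    0 ≤ sahiE (coinWeight μ h) m (fun j => ind (andCoin (A (s j)) (F (s j)))) :=
  ⟨(mixture_three hμ hμ1 A hA F m s).1.nonneg h0 h1, (mixture_three hμ hμ1 A hA F m s).2.nonneg h0 h1⟩

end Main

/-- **`MixtureBernsteinPositivity` restricted to `n = 3` is a theorem.** [this work] -/
theorem mixtureBernsteinPositivity_three :
    ∀ (α : Type) [Fintype α] (μ : α → ℝ), (∀ a, 0 ≤ μ a) → ∑ a, μ a = 1 →
      ∀ (A : Fin 3 → Set α) (F : Fin 3 → Bool), AllOrders μ A →
        ∀ (m : ℕ) (s : Fin m → Fin 3),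
          BernsteinPos m (fun h => sahiE (coinWeight μ h) m (fun j => ind (orCoin (A (s j)) (F (s j))))) ∧
          BernsteinPos m (fun h => sahiE (coinWeight μ h) m (fun j => ind (andCoin (A (s j)) (F (s j))))) :=
  fun _ _ _ hμ hμ1 A F hA m s => mixture_three hμ hμ1 A hA F m s

end SahiMixture

end Summit.CriticalPhenomena.PercolationContinuityZ3.Theorems

end
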